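import Mathlib
import HarnessLib
import Summits.ResolutionOfSingularities.ResolutionOfSingularities.Theorems.WildQuotientsWildQuotientResolutionConductorOnePresentation
import Summits.ResolutionOfSingularities.ResolutionOfSingularities.Theorems.WildQuotientsWildQuotientResolutionBlowupExitPresentationIdealTransfer
import Summits.ResolutionOfSingularities.ResolutionOfSingularities.Theorems.WildQuotientsWildQuotientResolutionBlowupLocalizationAway

/-!
# S2 F8, per-piece step: the local centre of a conductor-𝟙 piece with a regular blow-up
(crux stmt-ResolutionOfSingularities-15640 `WildQuotients.WildQuotientResolution`, line `Sketch`; chain w45c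
post-V5 programme S2, scaffold F8 (`L/res-L1-w45c-lead-1/S2-DESIGN.md` §4/§5; SIG pin
`L/res-L1-w45c-lead-1/stubs/ConductorOneF8Sig.lean`). [OURS · L1 W4.5c] — NOT a statement of the manuscript.
Lead prover res-L1-w45c-lead-1.)

Given a stable affine piece `O` of an equivariant model whose sections are identified by a SEAM
`e : Γ(O) ≃+* ChartRing k p n i I` with a `k`-algebra endomorphism `τ` of the chart ring satisfying the
diagonal-Möbius laws and cutting out the invariants (`x ∈ Γ(O)^G ↔ τ (e x) = e x`), and a toric centre
`J₀` of the weight-`0` cone (`J₀ ≠ ⊥`, `√J₀ =` irrelevant, `Bl_{J₀}` regular — F6/HT), the quotient piece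
`O/G` carries an ideal sheaf `𝔞 ≠ ⊥` with a REGULAR blow-up, supported on the image of the boolean point
`V(e⁻¹(x_1,…,x_n))` — the per-piece input of lemma G. Assembles F5 `ConductorOne.presentation`, the
presentation transfer `BlowupExit.exists_idealSheaf_of_presentation_ideal` and
`BlowupExit.isRegular_affineBlowup_map_away`.
-/

-- single-problem summit: the doubled namespace component `ResolutionOfSingularities` is forced
set_option linter.dupNamespace false

noncomputable section

open CategoryTheory AlgebraicGeometry TopologicalSpace MvPolynomial
open Literature.AlgebraicGeometry.Resolution Literature.AlgebraicGeometry.RelativeSpec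

namespace Summit.ResolutionOfSingularities.ResolutionOfSingularities.Theorems.WildQuotientResolution.ConductorOne

/-- `ν(0) = 1`: the cone element `ν` is non-zero. [OURS · L1 W4.5c] -/
theorem coneNu_ne_zero (k : Type) [Field k] (p n : ℕ) (i : Fin n) (I : Finset (Fin n)) [Fact p.Prime]
    (hi : i ∈ I) : coneNu k p n i I hi ≠ 0 := by
  intro h
  have hp : p - 1 ≠ 0 := by have := (Fact.out : p.Prime).two_le; omega
  have hp' : p ≠ 0 := (Fact.out : p.Prime).ne_zero
  have h1 : (coneNu k p n i I hi : MvPolynomial (Fin n) k) = 0 := by rw [h]; rfl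
  have h2 := congrArg (MvPolynomial.eval (fun _ : Fin n => (0 : k))) h1
  change MvPolynomial.eval (fun _ : Fin n => (0 : k)) (coneNuPoly k p n i I) = _ at h2
  unfold coneNuPoly at h2
  simp only [map_mul, map_prod, map_add, map_sub, map_one, map_pow, eval_X, zero_pow hp, zero_pow hp',
    mul_zero, sub_zero, add_zero, Finset.prod_const_one, mul_one, map_zero] at h2
  exact one_ne_zero h2

/-- The cone is a domain (a subalgebra of a polynomial ring over a field). [folklore] -/
theorem cone_isDomain (k : Type) [Field k] (n p : ℕ) (w : Fin n → ZMod p) : IsDomain (PthCone.cone k n p w) :=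
  inferInstance

/-- **The per-piece brick.** See the module docstring. [OURS · L1 W4.5c] -/
theorem exists_pieceCentre {X S : Scheme.{0}} {r : X ⟶ S}
    {G : Type} [Group G] [Finite G] (ρ : ActionOver r G) [S.IsSeparated] [IsSeparated r]
    [IsAffine S] (O : ρ.StableAffineOpens)
    (k : Type) [Field k] (p n : ℕ) (i : Fin n) (I : Finset (Fin n)) [Fact p.Prime] [CharP k p]
    (hi : i ∈ I)
    (e : Γ((O.1 : Scheme.{0}), (O.1.ι ≫ r) ⁻¹ᵁ ⊤) ≃+* ChartRing k p n i I)
    (τ : ChartRing k p n i I →ₐ[k] ChartRing k p n i I)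
    (hτ : IsChartAction k p n i I (τ : ChartRing k p n i I →+* ChartRing k p n i I))
    (hinv : ∀ x, x ∈ (ρ.restrict O.1 O.2.1).invariantsRing ⊤ ↔ τ (e x) = e x)
    (J₀ : Ideal (PthCone.cone k n p (chartWeight p n I))) (hJ0 : J₀ ≠ ⊥)
    (hrad : J₀.radical = PthCone.irrelevant k n p (chartWeight p n I))
    (hreg : Scheme.IsRegular (affineBlowup J₀)) :
    ∃ 𝔞 : (ρ.pieceQuot O).IdealSheafData,
      𝔞 ≠ ⊥ ∧
      (∃ (B : Scheme.{0}) (pB : B ⟶ ρ.pieceQuot O), IsBlowup pB 𝔞 ∧ Scheme.IsRegular B) ∧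
      ((𝔞.support : Set (ρ.pieceQuot O)) =
        (ρ.pieceMk O).base '' ((O.1 : Scheme.{0}).zeroLocus
          ((e.symm : ChartRing k p n i I → _) '' Set.range (chartX k p n i I)))) := by
  obtain ⟨ν, ψ, hψinj, hrange, -, hcomap⟩ := presentation k p n i I τ hτ hi
  haveI := cone_isDomain k n p (chartWeight p n I)
  -- the presentation of `Γ(O)^G`
  let ψ' : Localization.Away ν →+* Γ((O.1 : Scheme.{0}), (O.1.ι ≫ r) ⁻¹ᵁ ⊤) :=
    (e.symm : ChartRing k p n i I →+* _).comp (ψ : Localization.Away ν →+* ChartRing k p n i I)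
  have hψ'inj : Function.Injective ψ' := e.symm.injective.comp hψinj
  have hrange' : ψ'.range = (ρ.restrict O.1 O.2.1).invariantsRing ⊤ := by
    ext x
    rw [hinv, ← hrange, RingHom.mem_range]
    constructor
    · rintro ⟨z, rfl⟩
      exact ⟨z, (e.apply_symm_apply _).symm⟩
    · rintro ⟨z, hz⟩
      exact ⟨z, by change e.symm (ψ z) = x; rw [hz, e.symm_apply_apply]⟩
  -- the centre `J₀ · R₀[1/ν]`
  set J : Ideal (Localization.Away ν) := J₀.map (algebraMap _ (Localization.Away ν)) with hJdef
  -- `ν ≠ 0`, so the localisation map is injective and `J ≠ ⊥`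
  have hν0 : (ν : PthCone.cone k n p (chartWeight p n I)) ≠ 0 := by
    -- `ν` is the `coneNu` of the presentation up to the ∃; we only need `J ≠ ⊥`, which follows from
    -- injectivity of `ψ' ∘ algebraMap` on the domain `R₀` restricted... use the comap clause instead:
    intro h0
    -- if `ν = 0` the localisation is the zero ring, so `comap … = ⊤ ≠ irrelevant`
    haveI : Subsingleton (Localization.Away (ν : PthCone.cone k n p (chartWeight p n I))) := by
      have h00 : (0 : PthCone.cone k n p (chartWeight p n I)) ∈ Submonoid.powers ν := by
        rw [h0]; exact Submonoid.mem_powers _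
      exact (IsLocalization.uniqueOfZeroMem (S := Localization.Away ν) h00).instSubsingleton
    have htop : (Ideal.comap ψ (chartOrigin k p n i I)).comap
        (algebraMap (PthCone.cone k n p (chartWeight p n I)) (Localization.Away ν)) = ⊤ := by
      rw [Subsingleton.elim (Ideal.comap ψ (chartOrigin k p n i I)) ⊤, Ideal.comap_top]
    rw [hcomap] at htop
    exact (PthCone.irrelevant_isMaximal k n p (chartWeight p n I)).ne_top htop
  have hinjloc : Function.Injective (algebraMap (PthCone.cone k n p (chartWeight p n I)) (Localization.Away ν)) :=
    IsLocalization.injective (Localization.Away ν) (powers_le_nonZeroDivisors_of_noZeroDivisors hν0)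
  have hJ0' : J ≠ ⊥ := by
    intro h
    apply hJ0
    rw [hJdef, Ideal.map_eq_bot_iff_of_injective hinjloc] at h
    exact h
  have hreg' : Scheme.IsRegular (affineBlowup J) := BlowupExit.isRegular_affineBlowup_map_away J₀ ν hreg
  -- the radical clause
  set 𝔟 : Set Γ((O.1 : Scheme.{0}), (O.1.ι ≫ r) ⁻¹ᵁ ⊤) :=
    (e.symm : ChartRing k p n i I → _) '' Set.range (chartX k p n i I) with h𝔟
  have hcomapψ' : (Ideal.span 𝔟).comap ψ' = Ideal.comap ψ (chartOrigin k p n i I) := by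
    rw [show (Ideal.span 𝔟).comap ψ' =
        ((Ideal.span 𝔟).comap (e.symm : ChartRing k p n i I →+* _)).comap
          (ψ : Localization.Away ν →+* ChartRing k p n i I) from (Ideal.comap_comap _ _).symm]
    congr 1
    rw [h𝔟, ← Ideal.map_span, chartOrigin]
    change Ideal.comap e.symm.toRingHom (Ideal.map e.symm.toRingHom _) = _
    exact Ideal.comap_map_of_bijective e.symm.toRingHom e.symm.bijective
  have hJ : ((Ideal.span 𝔟).comap ψ').radical = J.radical := by
    rw [hcomapψ']
    -- `P := ψ⁻¹(𝔪_Q)` is extended from `R₀`: `P = (P ∩ R₀) · R₀[1/ν] = irrelevant · R₀[1/ν]`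
    have hP : Ideal.comap ψ (chartOrigin k p n i I) =
        (PthCone.irrelevant k n p (chartWeight p n I)).map
          (algebraMap (PthCone.cone k n p (chartWeight p n I)) (Localization.Away ν)) := by
      rw [← hcomap]
      exact (IsLocalization.map_under (Submonoid.powers ν) (Localization.Away ν) _).symm
    rw [hP, ← hrad, hJdef]
    apply le_antisymm
    · exact Ideal.radical_le_radical_iff.mpr (Ideal.map_radical_le _)
    · exact Ideal.radical_mono (Ideal.map_mono J₀.le_radical)
  exact BlowupExit.exists_idealSheaf_of_presentation_ideal ρ O ψ' hψ'inj hrange' J hJ0' hreg' 𝔟 hJ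

end Summit.ResolutionOfSingularities.ResolutionOfSingularities.Theorems.WildQuotientResolution.ConductorOne

end
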